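import Summits.Ventures.QEDPrecision.Integrands.KallenSabryIBP

/-!
# (R-IBP) complements: the explicit (definition-free) form of `Φ`, and the elementary forms of the controls `C₆` (sixth-order Källén–Sabry insertion) and `C₈/2` (the factorised `Π₂·Π₄` integral)

HONEST FRAMING: independent recomputation; certified where stated, statistical where stated; no new-physics claim.

Cell `pub-qed`, unit `pub-qed-lit` (venture `QEDPrecision`). The kernel theorem (R-IBP) OF RECORD is quad's
`Summit.Ventures.QEDPrecision.Integrands.integral_rho4_div_wt_eq_integral_phiIBP` (file
`Integrands/KallenSabryIBP.lean`, with `setIbRep_eq_integral_phiIBP`, `setIcRep_eq_integral_phiIBP`): for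
`0 < x < 1`, `∫₀¹ ρ₄(t)/W_t(x) dt = ∫₀¹ Φ(t,x) dt` with `Φ = phiIBP x t` built from the typed ingredients
`ksP, ksQ, ksPrim, ksS, ksT2, ksT3, ksT4` of the cell memo `certs/SetIbIc/repr/R-IBP.md` (objects: `ρ₄` =
[cite: Jegerlehner2017, eq. (3.160)], `W_t(x)` = [cite: Jegerlehner2017, eq. (3.158)], typed in
`Literature/…/Jegerlehner2017/SpectralFunctionInsertions.lean`). This theorems-only file (the ONE complement agreed
in the cell, lead decision D228; lit's concurrent partial chain is `KallenSabry/RIBPParts.lean`) adds what that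
file does not carry:
* `phiIBP_eq_explicit` — `phiIBP x t` unfolded to the memo's formula WRITTEN OUT (no definitions), so that a
  token-by-token comparison with R-IBP.md / the certificate's integrand program needs no unfolding by hand; and
  `integral_rho4_div_wt_eq_integral_explicit` — (R-IBP) in that explicit form;
* the `J`-generic transports `seqInsertion_rho4_congr`, `integral_rho2_rho4_congr` (any form `J` of
  `J₄(x) = ∫₀¹ρ₄/W_t(x)` on `(0,1)` may be substituted inside the typed integrals (3.159)/(3.161)
  [cite: Jegerlehner2017, eqs. (3.159)–(3.161)]);
* the CONTROLS of the Set I(b)/I(c) certificate in elementary form: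
  `seqInsertion_rho4_one_one_eq_integral_phiIBP` — `C₆ := seqInsertion ρ₄ 1 1 = ∫₀¹(1−x)(∫₀¹Φ)dx` (the
  sixth-order Källén–Sabry insertion; its printed closed form `KaptariLashkevichSolovtsova2025.vp6KallenSabry` is
  NOT proved equal to it here or anywhere in the tree), and `integral_rho2_rho4_eq_integral_phiIBP` —
  `∫₀¹(1−x)(∫ρ₂/W)(∫ρ₄/W)dx = ∫₀¹(1−x)K(x)(∫₀¹Φ)dx`, `K` the closed one-loop kernel
  (`integral_rho2_div_wt_eq`); twice this is the eighth-order subgroup I(b) ("a Π₂ and a Π₄ in a second-order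
  vertex", Kinoshita–Nio PRD 73 (2006) 013003 §3) = the control `C₈` (Laporta 2017 set 18 by value — a
  numerical statement of the certificate, NOT asserted here).
No value of any integral is asserted; no definitions; no `sorry`; zero `kit` compute; axioms standard.
-/

noncomputable section

open Real Set MeasureTheory intervalIntegral

namespace Summit.Ventures.QEDPrecision.KallenSabry

open Literature.MathematicalPhysics.QuantumFieldTheory.Jegerlehner2017 (rho2 rho4 wt seqInsertion
  integral_rho2_div_wt_eq)
open Summit.Ventures.QEDPrecision.Integrands (phiIBP ksP ksQ ksPrim ksS ksT2 ksT3 ksT4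
  integral_rho4_div_wt_eq_integral_phiIBP)

/-! ## `Φ` written out -/

/-- `phiIBP x t` IS, token for token, the memo's
`Φ = q·ln((1+t)/2)·ln((1+t)/(1−t)) + p·(T₂·ln((1+t)/(1−t)) + T₃ + T₄) + P·S` with `p, q = p(3−t²)(1+t²)/2, T₂, T₃,
T₄, P (a = (2−x)/x), S` substituted (definitional unfolding only). [folklore] -/
theorem phiIBP_eq_explicit (x t : ℝ) :
    phiIBP x t =
      (2 * t * x ^ 2 / (3 * ((2 - x) ^ 2 - x ^ 2 * t ^ 2)) * ((3 - t ^ 2) * (1 + t ^ 2) / 2)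
            * log ((1 + t) / 2) * log ((1 + t) / (1 - t))
          + 2 * t * x ^ 2 / (3 * ((2 - x) ^ 2 - x ^ 2 * t ^ 2)) *
            ((11 / 16 * (3 - t ^ 2) * (1 + t ^ 2) + t ^ 4 / 4 - 3 / 2 * t * (3 - t ^ 2))
                * log ((1 + t) / (1 - t))
              + t * (3 - t ^ 2) * (3 * log ((1 + t) / 2) - 2 * log t) + 3 / 8 * t * (5 - 3 * t ^ 2))
          + 1 / 6 * (t ^ 4 / 2 + (((2 - x) / x) ^ 2 - 2) * t ^ 2
              + (((2 - x) / x) ^ 2 - 3) * (((2 - x) / x) ^ 2 + 1) * log (1 - t ^ 2 / ((2 - x) / x) ^ 2))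
            * (-4 * log (2 * t / (1 + t)) / (1 - t ^ 2) + 2 * log ((1 - t) / 2) / (1 + t)
                + 2 * log ((1 + t) / 2) / (1 - t) - 2 * log (1 - t) / t + 2 * log (1 + t) / t)) := by
  simp only [phiIBP, ksQ, ksP, ksPrim, ksS, ksT2, ksT3, ksT4]

/-- (R-IBP) with `Φ` written out: for `0 < x < 1`, `∫₀¹ ρ₄(t)/W_t(x) dt = ∫₀¹ Φ(t,x) dt` (quad's kernel theorem
`integral_rho4_div_wt_eq_integral_phiIBP`, unfolded by `phiIBP_eq_explicit`). [folklore] -/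
theorem integral_rho4_div_wt_eq_integral_explicit {x : ℝ} (hx0 : 0 < x) (hx1 : x < 1) :
    ∫ t in (0:ℝ)..1, rho4 t / wt t x 1 =
    ∫ t in (0:ℝ)..1,
      (2 * t * x ^ 2 / (3 * ((2 - x) ^ 2 - x ^ 2 * t ^ 2)) * ((3 - t ^ 2) * (1 + t ^ 2) / 2)
            * log ((1 + t) / 2) * log ((1 + t) / (1 - t))
          + 2 * t * x ^ 2 / (3 * ((2 - x) ^ 2 - x ^ 2 * t ^ 2)) *
            ((11 / 16 * (3 - t ^ 2) * (1 + t ^ 2) + t ^ 4 / 4 - 3 / 2 * t * (3 - t ^ 2))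
                * log ((1 + t) / (1 - t))
              + t * (3 - t ^ 2) * (3 * log ((1 + t) / 2) - 2 * log t) + 3 / 8 * t * (5 - 3 * t ^ 2))
          + 1 / 6 * (t ^ 4 / 2 + (((2 - x) / x) ^ 2 - 2) * t ^ 2
              + (((2 - x) / x) ^ 2 - 3) * (((2 - x) / x) ^ 2 + 1) * log (1 - t ^ 2 / ((2 - x) / x) ^ 2))
            * (-4 * log (2 * t / (1 + t)) / (1 - t ^ 2) + 2 * log ((1 - t) / 2) / (1 + t)
                + 2 * log ((1 + t) / 2) / (1 - t) - 2 * log (1 - t) / t + 2 * log (1 + t) / t)) := by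
  rw [integral_rho4_div_wt_eq_integral_phiIBP hx0 hx1]
  simp only [phiIBP_eq_explicit]

/-! ## Generic transports into the typed integrals (3.159)/(3.161) -/

/-- Any form `J` of `J₄` on `(0,1)` may be substituted in the sequential-insertion integral with the Källén–Sabry
density: `seqInsertion ρ₄ n 1 = ∫₀¹(1−x)(J x)ⁿ dx`. [folklore] -/
theorem seqInsertion_rho4_congr {J : ℝ → ℝ}
    (hJ : ∀ x ∈ Ioo (0:ℝ) 1, ∫ t in (0:ℝ)..1, rho4 t / wt t x 1 = J x) (n : ℕ) :
    seqInsertion rho4 n 1 = ∫ x in (0:ℝ)..1, (1 - x) * (J x) ^ n := by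
  unfold seqInsertion
  refine intervalIntegral.integral_congr_uIoo ?_
  intro x hx
  rw [uIoo_of_le zero_le_one] at hx
  simp only
  rw [hJ x hx]

/-- The same for the factorised `Π₂·Π₄` integral of (3.161), with the inner one-loop integral in closed form:
`∫₀¹(1−x)(∫ρ₂/W)(∫ρ₄/W)dx = ∫₀¹(1−x)K(x)J(x)dx`. [folklore] -/
theorem integral_rho2_rho4_congr {J : ℝ → ℝ}
    (hJ : ∀ x ∈ Ioo (0:ℝ) 1, ∫ t in (0:ℝ)..1, rho4 t / wt t x 1 = J x) :
    ∫ x in (0:ℝ)..1, (1 - x) * (∫ t in (0:ℝ)..1, rho2 t / wt t x 1) * (∫ t in (0:ℝ)..1, rho4 t / wt t x 1)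
      = ∫ x in (0:ℝ)..1, (1 - x) *
        (4 / (3 * x ^ 2) - 4 / (3 * x) - 5 / 9 + (x ^ 3 - 6 * x + 4) / (3 * x ^ 3) * log (1 - x))
          * J x := by
  refine intervalIntegral.integral_congr_uIoo ?_
  intro x hx
  rw [uIoo_of_le zero_le_one] at hx
  simp only
  rw [hJ x hx, integral_rho2_div_wt_eq hx.1 hx.2]

/-! ## The controls `C₆` and `C₈/2` in elementary form -/

/-- **`C₆` in elementary form**: the sixth-order Källén–Sabry insertion coefficient
`seqInsertion ρ₄ 1 1 = ∫₀¹dx(1−x)∫₀¹dt ρ₄(t)/W_t(x)` equals `∫₀¹ (1−x) (∫₀¹ Φ(t,x) dt) dx`. [folklore] -/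
theorem seqInsertion_rho4_one_one_eq_integral_phiIBP :
    seqInsertion rho4 1 1 = ∫ x in (0:ℝ)..1, (1 - x) * ∫ t in (0:ℝ)..1, phiIBP x t := by
  rw [seqInsertion_rho4_congr (fun _ hx => integral_rho4_div_wt_eq_integral_phiIBP hx.1 hx.2) 1]
  simp only [pow_one]

/-- **`C₈/2` in elementary form**: `∫₀¹(1−x)(∫₀¹ρ₂/W_t(x))(∫₀¹ρ₄/W_t(x))dx = ∫₀¹ (1−x) K(x) (∫₀¹ Φ(t,x) dt) dx`
(twice this is the eighth-order subgroup I(b), one `Π₂` and one `Π₄` on the second-order vertex).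
[folklore] -/
theorem integral_rho2_rho4_eq_integral_phiIBP :
    ∫ x in (0:ℝ)..1, (1 - x) * (∫ t in (0:ℝ)..1, rho2 t / wt t x 1) * (∫ t in (0:ℝ)..1, rho4 t / wt t x 1)
      = ∫ x in (0:ℝ)..1, (1 - x) *
        (4 / (3 * x ^ 2) - 4 / (3 * x) - 5 / 9 + (x ^ 3 - 6 * x + 4) / (3 * x ^ 3) * log (1 - x))
          * ∫ t in (0:ℝ)..1, phiIBP x t :=
  integral_rho2_rho4_congr (fun _ hx => integral_rho4_div_wt_eq_integral_phiIBP hx.1 hx.2)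

end Summit.Ventures.QEDPrecision.KallenSabry

end
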